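import Summits.HubbardSuperconductivity.HubbardSuperconductivity.Theorems.AnisotropyChordTransferTheorem

/-!
# NEGATIVE LEMMA — the landed hypothesis (H3) `Transfer.SectorZeroGlobalGround Δ` is FALSE for every `Δ > −4/5`

(critic seat `hubbard-pc-critic-4` g4, MECHANISM CRITIC of the D-0159 lens wave; supports the rotor rung
`stmt-HubbardSuperconductivity-19089`; nothing here is a statement about the Hubbard model.)

`Theorems/AnisotropyChordTransferTheorem.lean` (prover seat `hubbard-h0-rotor-p1` g13, p656201) ports the theory seat's
hypothesis (H3) as
`SectorZeroGlobalGround Δ := ∀ (L : ℕ) [NeZero L] (M : ℝ) (a), IsPerronSectorGroundAmplitude L Δ M a → sectorE L Δ 0 ≤ sectorE L Δ M`,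
i.e. WITHOUT the `Even L →` guard of the theory seat's final `PartE.lean` (sha16 8c66b2344f7aca4a, l.73–75).  On an ODD torus the
integer sector `Sᶻ_tot = 0` is EMPTY, so `sectorE L Δ 0 = Matrix.minEnergyOn _ ⊥ = sInf ∅ = 0` is a junk value, while every
non-empty sector of the easy-plane ferromagnet has NEGATIVE ground energy.  Witness `L = 3`: the sector `M = 7/2` (one flipped spin)
carries a Perron amplitude (`exists_perron_of_weight`), and the `k = 0` one-magnon amplitude (indicator of the nine single-flip
configurations) has `⟨H(Δ)⟩ = −(D/8)(4 + 5Δ)` with `D = Σ_x Σ_y [x ∼ y] > 0` (exactly `−18 − (45/2)Δ`, norm² `9`), negative for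
`Δ > −4/5`; hence `sectorE 3 Δ (7/2) < 0 = sectorE 3 Δ 0`, contradicting (H3) at `(L, M) = (3, 7/2)`.

CONSEQUENCE (bookkeeping, not mathematics): `transferTheorem_holds`, `condensateOnFirstSectors_of_hypotheses` and
`condensateOnFirstSectors_of_gap` are vacuous implications as they stand (their hypothesis (H3) is unsatisfiable on the whole range
`0 ≤ Δ < 1`); the repair is to re-key them to the guarded statement `∀ L [NeZero L], Even L → …` (the theory seat's final text,
= THEOREM Z⁺'s torus corollary, Mattis 1979 / Nishimori 1981 / Tasaki 2018 p.7), feeding `Even L` from `even_of_perron_nat`.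
-/

set_option linter.dupNamespace false
set_option autoImplicit false

noncomputable section

open Finset
open Literature.MathematicalPhysics.QuantumLattice Literature.Probability.LatticeModels
open Summit.HubbardSuperconductivity.HubbardSuperconductivity.Theorems.AnisotropyChord.InsertionEntropy
open Summit.HubbardSuperconductivity.HubbardSuperconductivity.Theorems.AnisotropyChord.Tower
open Summit.HubbardSuperconductivity.HubbardSuperconductivity.Theorems.AnisotropyChord

namespace Summit.HubbardSuperconductivity.HubbardSuperconductivity.Theorems.AnisotropyChord.Transfer

namespace OddTorusRefutation

/-! ## The `3 × 3` torus: the half-filling sector is empty, its "sector energy" is the junk value `0` -/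

/-- `|V| = 9` for the `3 × 3` torus. [folklore] -/
theorem card_torusSite_three : Fintype.card (TorusSite 2 3) = 9 := by
  rw [Fintype.card_fun, ZMod.card, Fintype.card_fin]; norm_num

/-- On the `3 × 3` torus no spin-½ configuration has magnetisation `0` (`Sᶻ_tot` is half-odd). [folklore] -/
theorem mag_ne_zero_three (σ : TensorIndex (TorusSite 2 3) 2) : mag 1 σ ≠ 0 := by
  intro h
  unfold mag at h
  rw [Finset.sum_sub_distrib, Finset.sum_const, Finset.card_univ, card_torusSite_three,
    nsmul_eq_mul] at h
  have hsum : (((∑ x, (σ x : ℕ)) : ℕ) : ℝ) = ∑ x, ((σ x : ℕ) : ℝ) := by push_cast; rfl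
  have h2 : ((2 * ∑ x, (σ x : ℕ) : ℕ) : ℝ) = ((9 : ℕ) : ℝ) := by
    push_cast
    rw [hsum] at *
    push_cast at h
    linarith
  have h3 : 2 * ∑ x, (σ x : ℕ) = 9 := by exact_mod_cast h2
  omega

/-- The `Sᶻ_tot = 0` sector of the `3 × 3` torus is the zero subspace. [folklore] -/
theorem spinZSector_zero_three_eq_bot : spinZSector (Λ := TorusSite 2 3) 1 (0 : ℝ) = ⊥ := by
  by_contra h
  obtain ⟨σ, hσ⟩ := (spinZSector_ne_bot_iff (Λ := TorusSite 2 3) 1 (0 : ℝ)).1 h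
  exact mag_ne_zero_three σ hσ

/-- JUNK VALUE: the "sector ground energy" of the EMPTY sector `0` of the `3 × 3` torus is `sInf ∅ = 0`, for every `Δ`. [folklore] -/
theorem sectorE_three_zero (Δ : ℝ) : sectorE 3 Δ 0 = 0 := by
  unfold sectorE lowestEnergyInSector
  rw [spinZSector_zero_three_eq_bot]
  unfold Matrix.minEnergyOn
  convert Real.sInf_empty
  ext E
  simp only [Set.mem_setOf_eq, Set.mem_empty_iff_false, iff_false, not_exists, not_and]
  intro ψ hψ h1 _
  rw [Submodule.mem_bot] at hψ
  subst hψ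
  simp at h1

/-! ## The `k = 0` one-magnon trial amplitude on the `3 × 3` torus
(no `def`s: the single-flip configurations `f z` and the magnon amplitude `m` are carried as explicit arguments with their
defining equations `hf`, `hm`, and instantiated by lambdas in the final theorem) -/

section Magnon

variable (f : TorusSite 2 3 → TensorIndex (TorusSite 2 3) 2) (m : TensorIndex (TorusSite 2 3) 2 → ℝ)

/-- `f` (single flip: spin down `1` at `z`, up `0` elsewhere) is injective. [folklore] -/
theorem flipCfg_injective (hf : ∀ z x, f z x = if x = z then 1 else 0) : Function.Injective f := by
  intro z z' h
  by_contra hne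
  have h1 := congrFun h z
  rw [hf, hf, if_neg hne, if_pos rfl] at h1
  exact absurd h1 (by decide)

/-- `f z x = 0 ↔ x ≠ z`. [folklore] -/
theorem flipCfg_eq_zero_iff (hf : ∀ z x, f z x = if x = z then 1 else 0) (z x : TorusSite 2 3) :
    f z x = 0 ↔ x ≠ z := by
  rw [hf]
  by_cases h : x = z
  · simp [h]
  · simp [h]

/-- `f z x = 1 ↔ x = z`. [folklore] -/
theorem flipCfg_eq_one_iff (hf : ∀ z x, f z x = if x = z then 1 else 0) (z x : TorusSite 2 3) :
    f z x = 1 ↔ x = z := by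
  rw [hf]
  by_cases h : x = z
  · simp [h]
  · simp [h]

/-- a transposition of sites carries single flips to single flips. [folklore] -/
theorem flipCfg_comp_swap (hf : ∀ z x, f z x = if x = z then 1 else 0) (z x y : TorusSite 2 3) :
    f z ∘ ⇑(Equiv.swap x y) = f (Equiv.swap x y z) := by
  funext w
  simp only [Function.comp]
  rw [hf, hf]
  have : (Equiv.swap x y w = z) ↔ (w = Equiv.swap x y z) := by
    constructor
    · intro h; rw [← h, Equiv.swap_apply_self]
    · intro h; rw [h, Equiv.swap_apply_self]
  by_cases h : w = Equiv.swap x y z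
  · rw [if_pos (this.2 h), if_pos h]
  · rw [if_neg (fun h' => h (this.1 h')), if_neg h]

/-- value of the magnon amplitude `m = Σ_z 𝟙[· = f z]` on a single flip. [folklore] -/
theorem magnon_flipCfg (hf : ∀ z x, f z x = if x = z then 1 else 0)
    (hm : ∀ τ, m τ = ∑ z : TorusSite 2 3, if τ = f z then (1 : ℝ) else 0) (z : TorusSite 2 3) :
    m (f z) = 1 := by
  rw [hm]
  have : ∀ z' : TorusSite 2 3, (f z = f z') ↔ (z = z') := fun z' =>
    ⟨fun h => flipCfg_injective f hf h, fun h => by rw [h]⟩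
  simp_rw [this]
  simp

/-- value off the single flips. [folklore] -/
theorem magnon_of_not (hm : ∀ τ, m τ = ∑ z : TorusSite 2 3, if τ = f z then (1 : ℝ) else 0)
    (τ : TensorIndex (TorusSite 2 3) 2) (h : ∀ z, τ ≠ f z) : m τ = 0 := by
  rw [hm]
  exact Finset.sum_eq_zero fun z _ => if_neg (h z)

/-- the magnon amplitude is `{0,1}`-valued: `m τ * m τ = m τ`. [folklore] -/
theorem magnon_mul_self (hf : ∀ z x, f z x = if x = z then 1 else 0)
    (hm : ∀ τ, m τ = ∑ z : TorusSite 2 3, if τ = f z then (1 : ℝ) else 0)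
    (τ : TensorIndex (TorusSite 2 3) 2) : m τ * m τ = m τ := by
  by_cases h : ∃ z, τ = f z
  · obtain ⟨z, rfl⟩ := h
    rw [magnon_flipCfg f m hf hm]; norm_num
  · push Not at h
    rw [magnon_of_not f m hm τ h]; norm_num

/-- summing against the magnon indicator = summing over the nine single flips. [folklore] -/
theorem sum_magnon_mul (hm : ∀ τ, m τ = ∑ z : TorusSite 2 3, if τ = f z then (1 : ℝ) else 0)
    (F : TensorIndex (TorusSite 2 3) 2 → ℝ) :
    ∑ τ, m τ * F τ = ∑ z : TorusSite 2 3, F (f z) := by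
  simp_rw [hm, Finset.sum_mul, ite_mul, one_mul, zero_mul]
  rw [Finset.sum_comm]
  refine Finset.sum_congr rfl fun z _ => ?_
  rw [Finset.sum_ite_eq' Finset.univ (f z)]
  simp

/-- `Σ_τ m τ ^ 2 = 9`. [folklore] -/
theorem sum_magnon_sq (hf : ∀ z x, f z x = if x = z then 1 else 0)
    (hm : ∀ τ, m τ = ∑ z : TorusSite 2 3, if τ = f z then (1 : ℝ) else 0) : ∑ τ, m τ ^ 2 = 9 := by
  have : ∀ τ, m τ ^ 2 = m τ * 1 := fun τ => by rw [sq, magnon_mul_self f m hf hm, mul_one]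
  simp_rw [this]
  rw [sum_magnon_mul f m hm]
  simp

/-- the magnon amplitude is invariant under every transposition of sites. [folklore] -/
theorem magnon_comp_swap (hf : ∀ z x, f z x = if x = z then 1 else 0)
    (hm : ∀ τ, m τ = ∑ z : TorusSite 2 3, if τ = f z then (1 : ℝ) else 0)
    (τ : TensorIndex (TorusSite 2 3) 2) (x y : TorusSite 2 3) :
    m (τ ∘ ⇑(Equiv.swap x y)) = m τ := by
  by_cases h : ∃ z, τ = f z
  · obtain ⟨z, rfl⟩ := h
    rw [flipCfg_comp_swap f hf, magnon_flipCfg f m hf hm, magnon_flipCfg f m hf hm]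
  · push Not at h
    have h' : ∀ z, τ ∘ ⇑(Equiv.swap x y) ≠ f z := by
      intro z hz
      apply h (Equiv.swap x y z)
      have : τ = (τ ∘ ⇑(Equiv.swap x y)) ∘ ⇑(Equiv.swap x y) := by
        funext w; simp [Function.comp, Equiv.swap_apply_self]
      rw [this, hz, flipCfg_comp_swap f hf]
    rw [magnon_of_not f m hm _ h', magnon_of_not f m hm _ h]

/-- the isotropic part `A = fmOp` annihilates the magnon amplitude (a top-multiplet state). [folklore] -/
theorem fmOp_magnon (hf : ∀ z x, f z x = if x = z then 1 else 0)
    (hm : ∀ τ, m τ = ∑ z : TorusSite 2 3, if τ = f z then (1 : ℝ) else 0) :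
    fmOp (torusGraph 2 3) m = fun _ => 0 :=
  fmOp_of_swapInvariant _ m fun x y _ σ => magnon_comp_swap f m hf hm σ x y

/-- single flips live in the sector with `|V| − 1 = 8` up spins. [folklore] -/
theorem zerosCard_flipCfg (hf : ∀ z x, f z x = if x = z then 1 else 0) (z : TorusSite 2 3) :
    zerosCard (f z) = 8 := by
  unfold zerosCard
  have : (univ.filter fun x => f z x = 0) = univ.erase z := by
    ext x
    simp only [Finset.mem_filter, Finset.mem_univ, true_and, Finset.mem_erase, and_true]
    exact flipCfg_eq_zero_iff f hf z x
  rw [this, Finset.card_erase_of_mem (Finset.mem_univ z), Finset.card_univ, card_torusSite_three]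
  norm_num

/-- `D = Σ_x Σ_y [x ∼ y] > 0`: the `3 × 3` torus has an edge (the value `D = 36` is not needed). [folklore] -/
theorem adjD_pos : 0 < ∑ x : TorusSite 2 3, ∑ y, if (torusGraph 2 3).Adj x y then (1 : ℝ) else 0 := by
  have hadj : (torusGraph 2 3).Adj 0 ((0 : TorusSite 2 3) + Pi.single (0 : Fin 2) 1) :=
    torusGraph_adj_add_single (by norm_num) 0 0
  have hinner : ∀ x : TorusSite 2 3, 0 ≤ ∑ y, if (torusGraph 2 3).Adj x y then (1 : ℝ) else 0 :=
    fun x => Finset.sum_nonneg fun y _ => by split_ifs <;> norm_num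
  have h0 : (1 : ℝ) ≤ ∑ y, if (torusGraph 2 3).Adj 0 y then (1 : ℝ) else 0 := by
    have h := Finset.single_le_sum (f := fun y => if (torusGraph 2 3).Adj 0 y then (1 : ℝ) else 0)
      (fun y _ => by split_ifs <;> norm_num) (Finset.mem_univ ((0 : TorusSite 2 3) + Pi.single (0 : Fin 2) 1))
    simp only [if_pos hadj] at h
    exact h
  have h1 := Finset.single_le_sum (f := fun x : TorusSite 2 3 => ∑ y, if (torusGraph 2 3).Adj x y then (1 : ℝ) else 0)
    (fun x _ => hinner x) (Finset.mem_univ (0 : TorusSite 2 3))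
  linarith

/-- broken (up–down) ordered edge count of a single flip = the degree of the flipped site. [folklore] -/
theorem brokenOrd_flipCfg (hf : ∀ z x, f z x = if x = z then 1 else 0) (z : TorusSite 2 3) :
    brokenOrd (torusGraph 2 3) (f z) = ∑ x, if (torusGraph 2 3).Adj x z then (1 : ℝ) else 0 := by
  unfold brokenOrd
  refine Finset.sum_congr rfl fun x _ => ?_
  have hy : ∀ y, ((torusGraph 2 3).Adj x y ∧ f z x = 0 ∧ f z y = 1) ↔ ((torusGraph 2 3).Adj x z ∧ y = z) := by
    intro y
    rw [flipCfg_eq_zero_iff f hf, flipCfg_eq_one_iff f hf]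
    constructor
    · rintro ⟨h1, -, rfl⟩; exact ⟨h1, rfl⟩
    · rintro ⟨h1, rfl⟩; exact ⟨h1, (torusGraph 2 3).ne_of_adj h1, rfl⟩
  simp_rw [hy]
  by_cases h : (torusGraph 2 3).Adj x z
  · simp [h]
  · simp [h]

/-- `Σ_z isingW(f z) = (9/8)·D − D/2 = (5/8)·D`. [folklore] -/
theorem sum_isingW_flipCfg (hf : ∀ z x, f z x = if x = z then 1 else 0) :
    ∑ z, isingW (torusGraph 2 3) (f z)
      = (5/8 : ℝ) * ∑ x : TorusSite 2 3, ∑ y, if (torusGraph 2 3).Adj x y then (1 : ℝ) else 0 := by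
  simp_rw [isingW_eq, brokenOrd_flipCfg f hf]
  rw [Finset.sum_sub_distrib, Finset.sum_const, Finset.card_univ, card_torusSite_three, nsmul_eq_mul,
    ← Finset.mul_sum]
  have hcomm : (∑ z : TorusSite 2 3, ∑ x, if (torusGraph 2 3).Adj x z then (1 : ℝ) else 0)
      = ∑ x : TorusSite 2 3, ∑ y, if (torusGraph 2 3).Adj x y then (1 : ℝ) else 0 := by
    rw [Finset.sum_comm]
  rw [hcomm]
  push_cast
  ring

/-- **the magnon energy:** `⟨m, H(Δ) m⟩ = −(D/8)(4 + 5Δ)` (`= −18 − (45/2)Δ`). [folklore] -/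
theorem energyQ_magnon (hf : ∀ z x, f z x = if x = z then 1 else 0)
    (hm : ∀ τ, m τ = ∑ z : TorusSite 2 3, if τ = f z then (1 : ℝ) else 0) (Δ : ℝ) :
    energyQ 3 Δ m
      = -((∑ x : TorusSite 2 3, ∑ y, if (torusGraph 2 3).Adj x y then (1 : ℝ) else 0) / 8) * (4 + 5 * Δ) := by
  rw [energyQ_eq_real, fmOp_magnon f m hf hm, sum_magnon_sq f m hf hm]
  have h1 : (∑ σ, m σ * ((fun _ => (0 : ℝ)) σ + (1 - Δ) * (isingW (torusGraph 2 3) σ * m σ)))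
      = (1 - Δ) * ∑ σ, m σ * isingW (torusGraph 2 3) σ := by
    rw [Finset.mul_sum]
    refine Finset.sum_congr rfl fun σ _ => ?_
    have := magnon_mul_self f m hf hm σ
    simp only [zero_add]
    calc m σ * ((1 - Δ) * (isingW (torusGraph 2 3) σ * m σ))
        = (1 - Δ) * ((m σ * m σ) * isingW (torusGraph 2 3) σ) := by ring
      _ = (1 - Δ) * (m σ * isingW (torusGraph 2 3) σ) := by rw [this]
  rw [h1, sum_magnon_mul f m hm, sum_isingW_flipCfg f hf]
  ring

end Magnon

/-! ## The refutation -/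

/-- **(H3) AS LANDED IS FALSE** for every `Δ > −4/5` (in particular on the whole THEOREM-T range `0 ≤ Δ < 1`):
`¬ SectorZeroGlobalGround Δ`.  Witness `(L, M) = (3, 7/2)`: the empty sector `0` (junk energy `0`) versus the negative-energy
one-magnon sector. [folklore] -/
theorem not_sectorZeroGlobalGround (Δ : ℝ) (hΔ : -4/5 < Δ) : ¬ SectorZeroGlobalGround Δ := by
  intro h
  obtain ⟨b, hb⟩ := exists_perron_of_weight (L := 3) Δ 1 (by norm_num)
  have h1 := h 3 _ b hb
  rw [sectorE_three_zero] at h1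
  -- the single-flip configurations and the `k = 0` magnon amplitude, as lambdas
  have hf : ∀ z x : TorusSite 2 3,
      (fun (z x : TorusSite 2 3) => if x = z then (1 : Fin 2) else 0) z x = if x = z then 1 else 0 :=
    fun _ _ => rfl
  have hm : ∀ τ : TensorIndex (TorusSite 2 3) 2,
      (fun τ : TensorIndex (TorusSite 2 3) 2 =>
          ∑ z : TorusSite 2 3, if τ = (fun (z x : TorusSite 2 3) => if x = z then (1 : Fin 2) else 0) z then (1 : ℝ) else 0) τ
        = ∑ z : TorusSite 2 3, if τ = (fun (z x : TorusSite 2 3) => if x = z then (1 : Fin 2) else 0) z then (1 : ℝ) else 0 :=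
    fun _ => rfl
  have hsupp : ∀ σ, (fun τ : TensorIndex (TorusSite 2 3) 2 =>
          ∑ z : TorusSite 2 3, if τ = (fun (z x : TorusSite 2 3) => if x = z then (1 : Fin 2) else 0) z then (1 : ℝ) else 0) σ ≠ 0 →
        zerosCard σ = (Fintype.card (TorusSite 2 3) : ℝ) / 2
          + ((((Fintype.card (TorusSite 2 3) * 1 : ℕ)) : ℝ) / 2 - ((1 : ℕ) : ℝ)) := by
    intro σ hσ
    by_cases hz : ∃ z, σ = (fun (z x : TorusSite 2 3) => if x = z then (1 : Fin 2) else 0) z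
    · obtain ⟨z, rfl⟩ := hz
      rw [zerosCard_flipCfg _ hf]
      push_cast
      rw [card_torusSite_three]
      norm_num
    · push Not at hz
      exact absurd (magnon_of_not _ _ hm σ hz) hσ
  have hvar := sectorE_mul_le_energyQ (L := 3) Δ _ _ hsupp
  rw [sum_magnon_sq _ _ hf hm, energyQ_magnon _ _ hf hm] at hvar
  have hD := adjD_pos
  nlinarith

/-- the THEOREM-T range: for `0 ≤ Δ` the landed (H3) fails. [folklore] -/
theorem not_sectorZeroGlobalGround_of_nonneg (Δ : ℝ) (hΔ : 0 ≤ Δ) : ¬ SectorZeroGlobalGround Δ :=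
  not_sectorZeroGlobalGround Δ (by linarith)

end OddTorusRefutation

end Summit.HubbardSuperconductivity.HubbardSuperconductivity.Theorems.AnisotropyChord.Transfer
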